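import Mathlib
import HarnessLib.Audit
import Summits.PneNP.PneNP.Theorems.PstarPairCoreNormal

/-!
# No chord inside an empty-core coincidence: the planner's Lemma X (ROUND-24, O1 at exact tightness; memo g22 §21, p3 STATUS 00:02Z)

FRONTIER range-avoidance ladder, rung F-N3, ROUND 24 (cell `pnp-ideate`, prover-2 memo `g22/O1-PAIRCORE-g22.md` §21; planner p3 g23 STATUS
2026-08-29T00:02:38Z "LEMMA X"; typed target `PstarCoreBoundTargets.TerminalPeelable` (p646951); restricted-model proof complexity — nothing here
bears on `P` versus `NP`).

In the empty-core branch of `PstarPairCoreNormal.PairCore.normalForm` the first constraint is the pure AND-sum `d₁ = (∅, F₁, β₁)` of an XOR edge set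
`F₁ ⊆ J₀ ∖ c` closing a cycle with the chord `c`, and `d₁ ∧ d₂` is unsatisfiable over ALL assignments.  The planner's combinatorial census (V5,
= prover-2's sharp filter, memo §21) certifies H₁₂ at census level PROVIDED `F₁` contains no other chord `c'` of `J₀`.  This file proves that
exclusion, elementarily (no rank rigidity):

* **`false_of_chord_in_coincidence`** — let `c' ∈ F₁` have AND variables `π, π'` lying in no other output of `F₁`, and such that every OTHER monomial
  of `d₂` touching `π` or `π'` has its partner outside the AND pairs of `F₁` (at exact tightness: menu monomials on privates have outside partners,
  `PstarMaxSharingReaders.partner_fresh_of_tight`); `F₁ ≠ {c'}`; `d₁ ∧ d₂` unsatisfiable everywhere, `d₂` satisfiable, and if `c'` is also a monomial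
  of `d₂` some assignment violates both (the flip of the common monomial).  Then `False`.
  PROOF.  Write `d₁ = A ⊕ π·π'` with `A` blind to `π, π'` and to outside variables.  `A` takes the value `β₁` somewhere (else `F₁ ∖ c'` would be a
  constant AND-sum, i.e. empty); there, with `π = π' = 0`, `d₁` holds, so `d₂` fails, also after flipping `π` (still `π' = 0`): the move of `d₂` under
  `π` vanishes.  A foreign gate `(π, z)` in `d₂` would flip that move when `z` is toggled (`z` is invisible to `d₁`) — so there is none; hence the move
  is the constant `[π ∈ C₂]`, which is therefore `0`; likewise for `π'`.  So `d₂ = B ⊕ ε·π·π'` with `B` blind to `π, π'`.  If `ε = 0`, adjust `π, π'`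
  at a point where `d₂` holds to make `d₁` hold too.  If `ε = 1`, comparing `(π,π') = (0,0)` and `(1,1)` gives `B ≡ A ⊕ β₁ ⊕ β₂ ⊕ 1`, i.e. `d₂ ≡ ¬d₁`,
  contradicting the doubly-violating assignment.

So (for the O1 chain at `k = 12`): in branch (B) the folded family `F₁` consists of NON-CHORDS of `J₀` only — with `PstarPairCoreNormal` /
`PstarCoincidenceMatching` (`#F₁`-components `≤ 2`) this is exactly the planner's filter V5 «`F₁` inside two σ-classes», which leaves `≥ 5` of the six
chords of every tight twelve-output centre structure (110 structures with one capable chord = the 110 `SliceGeneric` defects of j314774, 1690 with none).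
No Assumption A.
-/

set_option linter.dupNamespace false -- `Summit.PneNP.PneNP.…`: summit = sub-problem name (D-0017 single-conjunct layout)

open Finset Literature.Computability.Complexity
open Summit.PneNP.PneNP.Theorems.PstarSALevel (SimpleOverlap)
open Summit.PneNP.PneNP.Theorems.PstarFibrePolys (bit bit_xor bit_and bit_injective)
open Summit.PneNP.PneNP.Theorems.PstarGapOneAll (gval)
open Summit.PneNP.PneNP.Theorems.PstarGConstraint (gval_update_of_forall_ne eq_empty_of_gval_const andPairs_simple)
open Summit.PneNP.PneNP.Theorems.PstarFreshErase (bit_gval_erase)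
open Summit.PneNP.PneNP.Theorems.PstarChordReadFlip (mv gval_flip coef_congr mv_update_of_gate eq_of_pair)

namespace Summit.PneNP.PneNP.Theorems.PstarCoincidenceChord

variable {n m : ℕ} {I : LocalMap 4 n m}

/-- Splitting one monomial off a G-constraint (Boolean form of `PstarFreshErase.bit_gval_erase`). -/
theorem gval_eq_xor_erase (C : Finset (Fin n)) {G : Finset (Fin m)} {g : Fin m} (hg : g ∈ G) (x : Fin n → Bool) :
    gval I C G x = xor (gval I C (G.erase g) x) (x (I.vars g 2) && x (I.vars g 3)) := by
  apply bit_injective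
  rw [bit_gval_erase I C hg x, bit_xor, bit_and]

/-- The move of a G-constraint under flipping `v` only sees the partners of `v`. -/
theorem mv_congr (C : Finset (Fin n)) (G : Finset (Fin m)) (v : Fin n) {x x' : Fin n → Bool}
    (h : ∀ g ∈ G, (I.vars g 2 = v → x (I.vars g 3) = x' (I.vars g 3)) ∧ (I.vars g 3 = v → x (I.vars g 2) = x' (I.vars g 2))) :
    mv I C G v x = mv I C G v x' := by
  unfold mv
  rw [coef_congr I C G v (X := fun w => bit (x w)) (X' := fun w => bit (x' w)) fun g hg =>
    ⟨fun e => by simp only [(h g hg).1 e], fun e => by simp only [(h g hg).2 e]⟩]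

section Chord

variable {F₁ : Finset (Fin m)} {β₁ : Bool} {C₂ : Finset (Fin n)} {G₂ : Finset (Fin m)} {β₂ : Bool} {c' : Fin m}

/-- **NO CHORD INSIDE AN EMPTY-CORE COINCIDENCE (Lemma X).**  See the module docstring. -/
theorem false_of_chord_in_coincidence (hI : I.IsPure xorAndPred) (hS : SimpleOverlap I) (hc' : c' ∈ F₁) (hne : (F₁.erase c').Nonempty)
    (hF : ∀ f ∈ F₁, f ≠ c' → (I.vars f 2 ≠ I.vars c' 2 ∧ I.vars f 3 ≠ I.vars c' 2) ∧ (I.vars f 2 ≠ I.vars c' 3 ∧ I.vars f 3 ≠ I.vars c' 3))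
    (hG : ∀ g ∈ G₂, g ≠ c' → ∀ v z : Fin n, (v = I.vars c' 2 ∨ v = I.vars c' 3) →
      ((I.vars g 2 = v ∧ I.vars g 3 = z) ∨ (I.vars g 2 = z ∧ I.vars g 3 = v)) → ∀ f ∈ F₁, I.vars f 2 ≠ z ∧ I.vars f 3 ≠ z)
    (hU : ∀ x : Fin n → Bool, ¬ (gval I ∅ F₁ x = β₁ ∧ gval I C₂ G₂ x = β₂))
    (hS₂ : ∃ x : Fin n → Bool, gval I C₂ G₂ x = β₂)
    (hflip : c' ∈ G₂ → ∃ x : Fin n → Bool, gval I ∅ F₁ x ≠ β₁ ∧ gval I C₂ G₂ x ≠ β₂) : False := by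
  classical
  set π := I.vars c' 2 with hπ
  set π' := I.vars c' 3 with hπ'
  have hππ : π ≠ π' := fun e => absurd (hI.2 c' e) (by decide)
  -- `d₁ = A ⊕ π π'` with `A` blind to `π, π'`
  have hA : ∀ x : Fin n → Bool, gval I ∅ F₁ x = xor (gval I ∅ (F₁.erase c') x) (x π && x π') := fun x => gval_eq_xor_erase ∅ hc' x
  have hFe : ∀ f ∈ F₁.erase c', (I.vars f 2 ≠ π ∧ I.vars f 3 ≠ π) ∧ (I.vars f 2 ≠ π' ∧ I.vars f 3 ≠ π') :=
    fun f hf => hF f (mem_of_mem_erase hf) (ne_of_mem_erase hf)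
  have hAπ : ∀ (x : Fin n → Bool) (b : Bool), gval I ∅ (F₁.erase c') (Function.update x π b) = gval I ∅ (F₁.erase c') x :=
    fun x b => gval_update_of_forall_ne I x (notMem_empty π) (fun f hf => (hFe f hf).1) b
  have hAπ' : ∀ (x : Fin n → Bool) (b : Bool), gval I ∅ (F₁.erase c') (Function.update x π' b) = gval I ∅ (F₁.erase c') x :=
    fun x b => gval_update_of_forall_ne I x (notMem_empty π') (fun f hf => (hFe f hf).2) b
  -- Step 1: `A` takes the value `β₁`
  obtain ⟨x₀, hx₀⟩ : ∃ x : Fin n → Bool, gval I ∅ (F₁.erase c') x = β₁ := by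
    by_contra hno
    push Not at hno
    have hconst : ∀ x, gval I ∅ (F₁.erase c') x = !β₁ := fun x => by
      have := hno x; revert this; cases gval I ∅ (F₁.erase c') x <;> cases β₁ <;> decide
    obtain ⟨hnd, hdist⟩ := andPairs_simple I hI hS (F₁.erase c')
    obtain ⟨-, h0⟩ := eq_empty_of_gval_const I hnd hdist hconst
    exact hne.ne_empty h0
  -- generic facts on points with `π' = 0`
  have hD₁_flipπ : ∀ x : Fin n → Bool, x π' = false → gval I ∅ F₁ (Function.update x π (!x π)) = gval I ∅ F₁ x := by
    intro x h
    rw [hA, hA x, hAπ, Function.update_of_ne hππ.symm, h, Bool.and_false, Bool.and_false]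
  have hD₁_flipπ' : ∀ x : Fin n → Bool, x π = false → gval I ∅ F₁ (Function.update x π' (!x π')) = gval I ∅ F₁ x := by
    intro x h
    rw [hA, hA x, hAπ', Function.update_of_ne hππ, h, Bool.false_and, Bool.false_and]
  have hmvπ : ∀ x : Fin n → Bool, x π' = false → gval I ∅ F₁ x = β₁ → mv I C₂ G₂ π x = false := by
    intro x hx hD
    have h1 : gval I C₂ G₂ x ≠ β₂ := fun h => hU x ⟨hD, h⟩
    have h2 : gval I C₂ G₂ (Function.update x π (!x π)) ≠ β₂ := fun h => hU _ ⟨by rw [hD₁_flipπ x hx]; exact hD, h⟩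
    rw [gval_flip I C₂ G₂ hI x π] at h2
    revert h1 h2; cases gval I C₂ G₂ x <;> cases mv I C₂ G₂ π x <;> cases β₂ <;> decide
  have hmvπ' : ∀ x : Fin n → Bool, x π = false → gval I ∅ F₁ x = β₁ → mv I C₂ G₂ π' x = false := by
    intro x hx hD
    have h1 : gval I C₂ G₂ x ≠ β₂ := fun h => hU x ⟨hD, h⟩
    have h2 : gval I C₂ G₂ (Function.update x π' (!x π')) ≠ β₂ := fun h => hU _ ⟨by rw [hD₁_flipπ' x hx]; exact hD, h⟩
    rw [gval_flip I C₂ G₂ hI x π'] at h2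
    revert h1 h2; cases gval I C₂ G₂ x <;> cases mv I C₂ G₂ π' x <;> cases β₂ <;> decide
  -- the base point `x₁`: `A = β₁`, `π = π' = 0`
  set x₁ : Fin n → Bool := Function.update (Function.update x₀ π false) π' false with hx₁
  have hx₁π : x₁ π = false := by rw [hx₁, Function.update_of_ne hππ, Function.update_self]
  have hx₁π' : x₁ π' = false := by rw [hx₁, Function.update_self]
  have hA₁ : gval I ∅ (F₁.erase c') x₁ = β₁ := by rw [hx₁, hAπ', hAπ]; exact hx₀
  have hD₁x₁ : gval I ∅ F₁ x₁ = β₁ := by rw [hA, hA₁, hx₁π, Bool.false_and, Bool.xor_false]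
  -- Step 2: no foreign monomial of `d₂` touches `π` or `π'`
  have hnog : ∀ g ∈ G₂, g ≠ c' → (I.vars g 2 ≠ π ∧ I.vars g 3 ≠ π) ∧ (I.vars g 2 ≠ π' ∧ I.vars g 3 ≠ π') := by
    intro g hg hgc
    have h23 : I.vars g 2 ≠ I.vars g 3 := fun e => absurd (hI.2 g e) (by decide)
    -- a touching slot gives a pair `{v, z}` with `v ∈ {π, π'}`
    have kill : ∀ v z : Fin n, (v = π ∨ v = π') → ((I.vars g 2 = v ∧ I.vars g 3 = z) ∨ (I.vars g 2 = z ∧ I.vars g 3 = v)) → False := by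
      intro v z hv hpair
      have hzF := hG g hg hgc v z hv hpair
      obtain ⟨hzπ, hzπ'⟩ : z ≠ π ∧ z ≠ π' := ⟨fun e => (hzF c' hc').1 e.symm, fun e => (hzF c' hc').2 e.symm⟩
      have hD₁z : ∀ x : Fin n → Bool, gval I ∅ F₁ (Function.update x z (!x z)) = gval I ∅ F₁ x :=
        fun x => gval_update_of_forall_ne I x (notMem_empty z) hzF _
      rcases hv with rfl | rfl
      · -- gate on `π`
        have m1 := hmvπ x₁ hx₁π' hD₁x₁
        have m2 := hmvπ (Function.update x₁ z (!x₁ z)) (by rw [Function.update_of_ne hzπ'.symm]; exact hx₁π')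
          (by rw [hD₁z]; exact hD₁x₁)
        rw [mv_update_of_gate I C₂ G₂ hI hS hg hpair x₁, m1] at m2
        exact Bool.noConfusion m2
      · -- gate on `π'`
        have m1 := hmvπ' x₁ hx₁π hD₁x₁
        have m2 := hmvπ' (Function.update x₁ z (!x₁ z)) (by rw [Function.update_of_ne hzπ.symm]; exact hx₁π)
          (by rw [hD₁z]; exact hD₁x₁)
        rw [mv_update_of_gate I C₂ G₂ hI hS hg hpair x₁, m1] at m2
        exact Bool.noConfusion m2
    refine ⟨⟨fun e => kill π _ (Or.inl rfl) (Or.inl ⟨e, rfl⟩), fun e => kill π _ (Or.inl rfl) (Or.inr ⟨rfl, e⟩)⟩,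
      ⟨fun e => kill π' _ (Or.inr rfl) (Or.inl ⟨e, rfl⟩), fun e => kill π' _ (Or.inr rfl) (Or.inr ⟨rfl, e⟩)⟩⟩
  -- Step 3: the moves of `π`, `π'` are determined by the co-variable and vanish on `{π' = 0}` resp. `{π = 0}`
  have hmvπ_all : ∀ x : Fin n → Bool, x π' = false → mv I C₂ G₂ π x = false := by
    intro x hx
    rw [mv_congr C₂ G₂ π (x' := x₁) fun g hg => ?_]
    · exact hmvπ x₁ hx₁π' hD₁x₁
    · by_cases hgc : g = c'
      · subst hgc
        exact ⟨fun _ => by rw [← hπ', hx, hx₁π'], fun e => absurd e (Ne.symm hππ)⟩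
      · exact ⟨fun e => absurd e (hnog g hg hgc).1.1, fun e => absurd e (hnog g hg hgc).1.2⟩
  have hmvπ'_all : ∀ x : Fin n → Bool, x π = false → mv I C₂ G₂ π' x = false := by
    intro x hx
    rw [mv_congr C₂ G₂ π' (x' := x₁) fun g hg => ?_]
    · exact hmvπ' x₁ hx₁π hD₁x₁
    · by_cases hgc : g = c'
      · subst hgc
        exact ⟨fun e => absurd e hππ, fun _ => by rw [← hπ, hx, hx₁π]⟩
      · exact ⟨fun e => absurd e (hnog g hg hgc).2.1, fun e => absurd e (hnog g hg hgc).2.2⟩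
  -- flipping `π` (resp. `π'`) off the axis does not move `d₂`
  have key : ∀ x : Fin n → Bool, x π = false → x π' = false →
      gval I C₂ G₂ (Function.update x π' true) = gval I C₂ G₂ x ∧
      gval I C₂ G₂ (Function.update x π true) = gval I C₂ G₂ x := by
    intro x hxπ hxπ'
    constructor
    · have h := gval_flip I C₂ G₂ hI x π'
      rw [hxπ', Bool.not_false, hmvπ'_all x hxπ, Bool.xor_false] at h
      exact h
    · have h := gval_flip I C₂ G₂ hI x π
      rw [hxπ, Bool.not_false, hmvπ_all x hxπ', Bool.xor_false] at h
      exact h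
  -- Step 4: the four corners over a base point `u` with `π = π' = 0`
  have hε : ∀ u : Fin n → Bool, u π = false → u π' = false →
      mv I C₂ G₂ π' (Function.update u π true) = decide (c' ∈ G₂) := by
    intro u huπ huπ'
    have h0 := hmvπ'_all u huπ
    by_cases hcG : c' ∈ G₂
    · have h := mv_update_of_gate I C₂ G₂ hI hS hcG (v := π') (u := π) (Or.inr ⟨rfl, rfl⟩) u
      rw [huπ, Bool.not_false, h0] at h
      rw [h, decide_eq_true hcG]; rfl
    · have hno : ∀ g ∈ G₂, ¬ ((I.vars g 2 = π' ∧ I.vars g 3 = π) ∨ (I.vars g 2 = π ∧ I.vars g 3 = π')) := by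
        intro g hg hpair
        have : g = c' := eq_of_pair I hS (Ne.symm hππ) hpair (Or.inr ⟨rfl, rfl⟩)
        exact hcG (this ▸ hg)
      rw [PstarChordReadFlip.mv_update_of_ne I C₂ G₂ hno u true, h0, decide_eq_false hcG]
  have hcorner₂ : ∀ u : Fin n → Bool, u π = false → u π' = false → ∀ b b' : Bool,
      gval I C₂ G₂ (Function.update (Function.update u π b) π' b') = xor (gval I C₂ G₂ u) (decide (c' ∈ G₂) && (b && b')) := by
    intro u huπ huπ' b b'
    have eπ : Function.update u π false = u := by rw [show false = u π from huπ.symm, Function.update_eq_self]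
    have eπ' : ∀ v : Fin n → Bool, v π' = false → Function.update v π' false = v := fun v hv => by
      rw [show false = v π' from hv.symm, Function.update_eq_self]
    obtain ⟨k₁, k₂⟩ := key u huπ huπ'
    cases b <;> cases b'
    · rw [eπ, eπ' u huπ']; simp
    · rw [eπ, k₁]; simp
    · rw [eπ' _ (by rw [Function.update_of_ne hππ.symm]; exact huπ'), k₂]; simp
    · have h := gval_flip I C₂ G₂ hI (Function.update u π true) π'
      rw [Function.update_of_ne hππ.symm, huπ', Bool.not_false, hε u huπ huπ', k₂] at h
      rw [h]; cases gval I C₂ G₂ u <;> cases decide (c' ∈ G₂) <;> rfl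
  have hcorner₁ : ∀ u : Fin n → Bool, ∀ b b' : Bool,
      gval I ∅ F₁ (Function.update (Function.update u π b) π' b') = xor (gval I ∅ (F₁.erase c') u) (b && b') := by
    intro u b b'
    rw [hA, hAπ', hAπ, Function.update_self, Function.update_of_ne hππ, Function.update_self]
  have eq_corner : ∀ x : Fin n → Bool,
      x = Function.update (Function.update (Function.update (Function.update x π false) π' false) π (x π)) π' (x π') := by
    intro x; funext v
    by_cases hv' : v = π'
    · subst hv'; rw [Function.update_self]
    · rw [Function.update_of_ne hv']
      by_cases hv : v = π
      · subst hv; rw [Function.update_self]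
      · rw [Function.update_of_ne hv, Function.update_of_ne hv', Function.update_of_ne hv]
  -- the base point of an arbitrary `x`
  have base : ∀ x : Fin n → Bool, ∃ u : Fin n → Bool, u π = false ∧ u π' = false ∧
      gval I ∅ F₁ x = xor (gval I ∅ (F₁.erase c') u) (x π && x π') ∧
      gval I C₂ G₂ x = xor (gval I C₂ G₂ u) (decide (c' ∈ G₂) && (x π && x π')) ∧
      (∀ b b' : Bool, gval I ∅ F₁ (Function.update (Function.update u π b) π' b') = xor (gval I ∅ (F₁.erase c') u) (b && b') ∧
        gval I C₂ G₂ (Function.update (Function.update u π b) π' b') = xor (gval I C₂ G₂ u) (decide (c' ∈ G₂) && (b && b'))) := by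
    intro x
    set u : Fin n → Bool := Function.update (Function.update x π false) π' false with hu
    have huπ : u π = false := by rw [hu, Function.update_of_ne hππ, Function.update_self]
    have huπ' : u π' = false := by rw [hu, Function.update_self]
    refine ⟨u, huπ, huπ', ?_, ?_, fun b b' => ⟨hcorner₁ u b b', hcorner₂ u huπ huπ' b b'⟩⟩
    · conv_lhs => rw [eq_corner x]
      exact hcorner₁ u (x π) (x π')
    · conv_lhs => rw [eq_corner x]
      exact hcorner₂ u huπ huπ' (x π) (x π')
  by_cases hcG : c' ∈ G₂
  · -- `ε = 1`: `d₂ ≡ ¬ d₁`, contradicting the doubly-violating assignment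
    obtain ⟨x, hx₁', hx₂'⟩ := hflip hcG
    obtain ⟨u, -, -, e₁, e₂, hc⟩ := base x
    rw [decide_eq_true hcG, Bool.true_and] at e₂
    obtain ⟨c₁, c₂⟩ := hc true true
    rw [decide_eq_true hcG, Bool.true_and, Bool.and_self] at c₂
    rw [Bool.and_self] at c₁
    obtain ⟨d₁, d₂⟩ := hc false false
    rw [Bool.false_and, Bool.xor_false] at d₁
    rw [Bool.false_and, Bool.and_false, Bool.xor_false] at d₂
    rw [e₁] at hx₁'
    rw [e₂] at hx₂'
    -- case on the corner of `x`
    cases hq : (x π && x π')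
    · rw [hq, Bool.xor_false] at hx₁' hx₂'
      refine hU (Function.update (Function.update u π true) π' true) ⟨?_, ?_⟩
      · rw [c₁]; revert hx₁'; cases gval I ∅ (F₁.erase c') u <;> cases β₁ <;> decide
      · rw [c₂]; revert hx₂'; cases gval I C₂ G₂ u <;> cases β₂ <;> decide
    · rw [hq] at hx₁' hx₂'
      refine hU (Function.update (Function.update u π false) π' false) ⟨?_, ?_⟩
      · rw [d₁]; revert hx₁'; cases gval I ∅ (F₁.erase c') u <;> cases β₁ <;> decide
      · rw [d₂]; revert hx₂'; cases gval I C₂ G₂ u <;> cases β₂ <;> decide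
  · -- `ε = 0`: `π, π'` are free in `d₂`; repair `d₁` at a point where `d₂` holds
    obtain ⟨x, hx⟩ := hS₂
    obtain ⟨u, -, -, -, e₂, hc⟩ := base x
    rw [decide_eq_false hcG, Bool.false_and, Bool.xor_false] at e₂
    rw [e₂] at hx
    cases hAu : gval I ∅ (F₁.erase c') u
    · -- choose the corner with `b && b' = β₁`
      obtain ⟨c₁, c₂⟩ := hc β₁ β₁
      rw [decide_eq_false hcG, Bool.false_and, Bool.xor_false] at c₂
      rw [hAu, Bool.and_self, Bool.false_xor] at c₁
      exact hU _ ⟨c₁, by rw [c₂]; exact hx⟩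
    · obtain ⟨c₁, c₂⟩ := hc (!β₁) (!β₁)
      rw [decide_eq_false hcG, Bool.false_and, Bool.xor_false] at c₂
      rw [hAu, Bool.and_self] at c₁
      exact hU _ ⟨by rw [c₁]; cases β₁ <;> rfl, by rw [c₂]; exact hx⟩

end Chord

end Summit.PneNP.PneNP.Theorems.PstarCoincidenceChord
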